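import Literature.Analysis.FluidPDE.GKPCriticalElements
import HarnessLib

/-!
# Gallagher–Koch–Planchon 2016: persistence of regularity (1.9)+(1.6) and Props. 2.1–2.3
# (critical elements) — FAITHFUL forms over GKP's solution class

Topic `Analysis/FluidPDE`. Source: I. Gallagher, G. Koch, F. Planchon, *Blow-up of critical Besov
norms at a potential Navier–Stokes singularity*, Comm. Math. Phys. 343 (2016) 39–82 =
arXiv:1407.4156 [`GKP2016`]; read in the arXiv version (held text `paper:arxiv-1407.4156`), §1
p. 4 ((1.6) uniqueness and smoothness of `NS(u₀)` in `𝓛^{1:∞}_{p,q}(T)`; (1.9) "`T*(u₀)` is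
independent of `p` and `q` for any `p, q ∈ (3,∞)`", recalled there from Gallagher–Iftimie–Planchon
2003) and §2.1 p. 6 (the threshold `A_c`, the set `𝒟_c` of data generating critical elements,
**Propositions 2.1, 2.2, 2.3**, running assumption `p = q = 3·2^k − 2`). One file for §2.1
(D-0064); companion of `BesovBlowupCriteriaGKPClass.lean` (Thm. 1 / Albritton's Thm. 1.1).

These are the four named facts WANTED since the verdict clean-up of 2026-08-15: the tree-class
renderings `gkp_regularity_persistence`, `gkp_exists_criticalElement`,
`gkp_criticalElement_tendsto_zero` (deprecated, `GKPCriticalElements.lean`) and the former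
`gkp_rigidity` quantify over `IsBesovMildSolutionOn` / `IsMaximalBesovMildSolution`, not GKP's
class; the faithful statements are displayed in `GKPCriticalElements.lean` as the hypotheses `h`
of `gkp_regularity_persistence_of_identification`, `gkp_exists_criticalElement_of_identification`,
`gkp_criticalElement_tendsto_zero_of_identification`, `gkp_rigidity_of_identification`, and are
consumed verbatim as `h1`, `h2`, `h3` by
`hasSmoothExtensionPast_of_eHomBesovNorm_bounded_of_gkpProps3_gkpClass`
(`NSCriticalClosureBesovGKPClassProps.lean`). The definitions below ARE those hypotheses.

## The printed statements (`ν = 1`, `p = q = 3·2^k − 2` in §2.1)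

* (1.6) "`u₀ ∈ Ḃ^{s_p}_{p,q}`, `T > 0`, `u₁, u₂` satisfy (1.2) in `𝓛^{1:∞}_{p,q}(T)` `⟹`
  `u₁ = u₂ ∈ C([0,T]; Ḃ^{s_p}_{p,q}) ∩ C^∞(ℝ³ × (0,T])`"; (1.9) "`T*_{𝓛^{1:∞}_{p,q}(T)}(u₀)` is
  independent of `p` and `q` for any `p,q ∈ (3,∞)`."
* §2.1: "`A_c := sup{A > 0 | sup_{t∈[0,T*(u₀))} ‖NS(u₀)(t)‖_{Ḃ^{s_p}_{p,p}} ≤ A ⟹ T*(u₀) = ∞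
  ∀ u₀ ∈ Ḃ^{s_p}_{p,p}}`"; "`𝒟_c := {u₀ ∈ Ḃ^{s_p}_{p,p} | T*(u₀) < ∞ and
  sup_{t∈[0,T*(u₀))} ‖NS(u₀)(t)‖ = A_c < ∞}`".
* **Proposition 2.1** (Existence of a critical element). "If `A_c < ∞`, then the set `𝒟_c` is non
  empty."
* **Proposition 2.2** (Compactness at blow-up time of critical elements). "If `A_c < ∞`, then any
  `u₀` in `𝒟_c` satisfies `NS(u₀)(t) → 0` in `𝒮'`, as `t ↗ T*(u₀)`."
* **Proposition 2.3** (Rigidity of critical elements). "If `u₀` belongs to `Ḃ^{s_p}_{p,p}` with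
  `sup_{t∈[0,T*(u₀))} ‖NS(u₀)(t)‖_{Ḃ^{s_p}_{p,p}} < ∞` and if `NS(u₀)(t) → 0` in `𝒮'` as
  `t ↗ T*(u₀)`, then `T*(u₀) = ∞`."

## Contents (named facts, D-0014)

* `gkp_regularity_persistence_pathSpace` — (1.9) with (1.6).
* `gkp_exists_criticalElement_pathSpace` — Prop. 2.1.
* `gkp_criticalElement_tendsto_zero_pathSpace` — Prop. 2.2.
* `gkp_rigidity_pathSpace` — Prop. 2.3.

## Transcription notes

* *Vocabulary* (all `GKPCriticalElements.lean`): `IsGKPSolutionOn p q T ν u U` (a Besov mild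
  solution of the class `(s_p,p,q)` on `[0,T)` in the path space `𝓛^{1:∞}_{p,q}[T' < T]`, hence
  `NS(u₀)` there by (1.6)), `IsMaximalGKPSolution` (no extension in that class: `T = T*(u₀)`),
  `IsGKPExponent p` (`p = 3·2^k − 2`, `k ≥ 2`), `gkpCriticalThreshold ν p` (`A_c`),
  `IsGKPCriticalElement ν p T u U` (`u₀ ∈ 𝒟_c` with its maximal solution and lifespan `T`);
  `𝒮'`-convergence is Mathlib's topology of `TemperedDistribution`; Besov norms are
  `FunctionSpaces.eHomBesovNorm`. Function-valued solutions `(u, U)` as everywhere in the tree (the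
  device of §2.4 p. 8). Rendering choices are those fixed on 2026-08-15 by the authors of the
  consuming theorems; the present file only names the displayed statements.
* *Prop. 2.3* is recorded for a finite lifespan candidate `0 < T`: a GKP solution on `[0,T)` with
  bounded critical norm and `U t → 0` in `𝒮'` is NOT maximal with lifespan `T` (printed
  "`T*(u₀) = ∞`").
* *Viscosity.* Printed for `ν = 1`; general `ν > 0` by `w(y,s) = ν⁻¹u(y,s/ν)` as in
  `gkp_besov_blowup_pathSpace` (thresholds and classes transform accordingly; the consuming
  theorems quantify over `ν` in exactly this way).
* Not here: Theorem 1 (`gkp_besov_blowup_pathSpace`, `BesovBlowupCriteriaGKPClass.lean`), the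
  profile decomposition (Thm. 3), §§3–6.

## Mathlib / tree search

`lean search 'criticalElement_pathSpace|gkp_rigidity_pathSpace|regularity_persistence_pathSpace'`
(2026-08-26): only docstring mentions ("wanted named fact") and the hypothesis displays; no
declaration. No Mathlib content.

## References

* I. Gallagher, G. Koch, F. Planchon, Comm. Math. Phys. 343 (2016) = arXiv:1407.4156: §1 p. 4
  ((1.6), (1.9)), §2.1 p. 6 (`A_c`, `𝒟_c`, Props. 2.1–2.3). [`GKP2016`]
* I. Gallagher, D. Iftimie, F. Planchon, Ann. Inst. Fourier 53 (2003) (propagation of regularity,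
  the source of (1.9) as recalled in GKP 2016).
-/

noncomputable section

open MeasureTheory Set Filter
open _root_.Topology
open scoped SchwartzMap ENNReal NNReal

namespace Literature.Analysis.FluidPDE

/-- **GKP 2016, (1.9) with (1.6) (faithful form over GKP's class): the lifespan does not depend on
the exponents, and `NS(u₀)` lies in every critical class its datum belongs to.** For every
`ν > 0`, all exponents `p, q, p', q' ∈ (3,∞)` and `0 < T`: a GKP solution `(u, U)` on `[0,T)` in the
class `(s_{p'}, p', q')` whose initial distribution `U 0` lies in `Ḃ^{-1+3/p}_{p,q}` is a GKP
solution on `[0,T)` in the class `(s_p, p, q)`. Printed: (1.9) "`T*(u₀)` is independent of `p`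
and `q`", with the uniqueness/regularity (1.6) of `NS(u₀)` in `𝓛^{1:∞}_{p,q}(T)`. Verbatim the
hypothesis `h` of `gkp_regularity_persistence_of_identification`; replaces the deprecated
`gkp_regularity_persistence`. [cite: GKP2016, (1.9) with (1.6) (arXiv:1407.4156 §1 p. 4)] -/
def gkp_regularity_persistence_pathSpace : Prop :=
  ∀ ⦃ν : ℝ⦄, 0 < ν → ∀ ⦃p q p' q' : ℝ≥0∞⦄ [Fact (1 ≤ p)] [Fact (1 ≤ p')], 3 < p → p < ∞ →
    3 < q → q < ∞ → 3 < p' → p' < ∞ → 3 < q' → q' < ∞ → ∀ ⦃T : ℝ⦄, 0 < T →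
    ∀ ⦃u : ℝ → EuclideanSpace ℝ (Fin 3) → EuclideanSpace ℝ (Fin 3)⦄
      ⦃U : ℝ → 𝓢'(EuclideanSpace ℝ (Fin 3), EuclideanSpace ℂ (Fin 3))⦄,
      IsGKPSolutionOn p' q' T ν u U → FunctionSpaces.MemHomBesov (-1 + 3 / p.toReal) p q (U 0) →
      IsGKPSolutionOn p q T ν u U

/-- **GKP 2016, Proposition 2.1 (Existence of a critical element; faithful form).** For GKP
exponents `p = 3·2^k − 2` and every `ν > 0`: if `A_c < ∞` (`gkpCriticalThreshold ν p < ∞`), then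
`𝒟_c ≠ ∅` — some `(u, U)` is a GKP critical element with some lifespan `T`
(`IsGKPCriticalElement ν p T u U`). Printed: "If `A_c < ∞`, then the set `𝒟_c` is non empty."
Verbatim the hypothesis `h` of `gkp_exists_criticalElement_of_identification` (= `h1` of
`hasSmoothExtensionPast_of_eHomBesovNorm_bounded_of_gkpProps3_gkpClass`); replaces the deprecated
`gkp_exists_criticalElement`. [cite: GKP2016, Prop. 2.1 (arXiv:1407.4156 §2.1 p. 6)] -/
def gkp_exists_criticalElement_pathSpace : Prop :=
  ∀ ⦃ν : ℝ⦄, 0 < ν → ∀ ⦃p : ℝ≥0∞⦄ [Fact (1 ≤ p)], IsGKPExponent p →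
    gkpCriticalThreshold ν p < ∞ →
      ∃ (T : ℝ) (u : ℝ → EuclideanSpace ℝ (Fin 3) → EuclideanSpace ℝ (Fin 3))
        (U : ℝ → 𝓢'(EuclideanSpace ℝ (Fin 3), EuclideanSpace ℂ (Fin 3))),
        IsGKPCriticalElement ν p T u U

/-- **GKP 2016, Proposition 2.2 (Compactness at blow-up time of critical elements; faithful
form).** For GKP exponents `p` and every `ν > 0`: every GKP critical element `(u, U)` with lifespan
`T = T*(u₀)` satisfies `U t → 0` in `𝒮'` as `t → T⁻`. Printed: "If `A_c < ∞`, then any `u₀` in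
`𝒟_c` satisfies `NS(u₀)(t) → 0` in `𝒮'`, as `t ↗ T*(u₀)`" (`IsGKPCriticalElement` carries
`A_c < ∞`). Verbatim the hypothesis `h` of `gkp_criticalElement_tendsto_zero_of_identification`
(= `h2` of `hasSmoothExtensionPast_of_eHomBesovNorm_bounded_of_gkpProps3_gkpClass`); replaces the
deprecated `gkp_criticalElement_tendsto_zero`. [cite: GKP2016, Prop. 2.2 (arXiv:1407.4156 §2.1 p. 6)] -/
def gkp_criticalElement_tendsto_zero_pathSpace : Prop :=
  ∀ ⦃ν : ℝ⦄, 0 < ν → ∀ ⦃p : ℝ≥0∞⦄ [Fact (1 ≤ p)], IsGKPExponent p → ∀ ⦃T : ℝ⦄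
    ⦃u : ℝ → EuclideanSpace ℝ (Fin 3) → EuclideanSpace ℝ (Fin 3)⦄
    ⦃U : ℝ → 𝓢'(EuclideanSpace ℝ (Fin 3), EuclideanSpace ℂ (Fin 3))⦄,
    IsGKPCriticalElement ν p T u U → Tendsto U (𝓝[<] T) (𝓝 0)

/-- **GKP 2016, Proposition 2.3 (Rigidity of critical elements; faithful form).** For GKP
exponents `p` and every `ν > 0`: a GKP solution `(u, U)` on `[0,T)`, `0 < T`, of the class
`(s_p, p, p)` with `sup_{[0,T)} ‖U t‖_{Ḃ^{s_p}_{p,p}} < ∞` and `U t → 0` in `𝒮'` as `t → T⁻` is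
not a maximal GKP solution with lifespan `T` (`T < T*(u₀)`). Printed: "If `u₀` belongs to
`Ḃ^{s_p}_{p,p}` with `sup_{t∈[0,T*(u₀))} ‖NS(u₀)(t)‖ < ∞` and if `NS(u₀)(t) → 0` in `𝒮'` as
`t ↗ T*(u₀)`, then `T*(u₀) = ∞`." Verbatim the hypothesis `h` of `gkp_rigidity_of_identification`
(= `h3` of `hasSmoothExtensionPast_of_eHomBesovNorm_bounded_of_gkpProps3_gkpClass`, and the
conclusion of `gkp_rigidity_pathSpace_of_blowup_pathSpace`). [cite: GKP2016, Prop. 2.3 (arXiv:1407.4156 §2.1 p. 6)] -/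
def gkp_rigidity_pathSpace : Prop :=
  ∀ ⦃ν : ℝ⦄, 0 < ν → ∀ ⦃p : ℝ≥0∞⦄ [Fact (1 ≤ p)], IsGKPExponent p → ∀ ⦃T : ℝ⦄, 0 < T →
    ∀ ⦃u : ℝ → EuclideanSpace ℝ (Fin 3) → EuclideanSpace ℝ (Fin 3)⦄
      ⦃U : ℝ → 𝓢'(EuclideanSpace ℝ (Fin 3), EuclideanSpace ℂ (Fin 3))⦄,
      IsGKPSolutionOn p p T ν u U →
      ⨆ t ∈ Ico 0 T, FunctionSpaces.eHomBesovNorm (-1 + 3 / p.toReal) p p (U t) < ∞ →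
      Tendsto U (𝓝[<] T) (𝓝 0) → ¬ IsMaximalGKPSolution p p T ν u U

end Literature.Analysis.FluidPDE

end
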